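import Mathlib
import HarnessLib

/-!
# Bilinear parallelogram bounds from LINE second differences for a NORM-BOUND PREDICATE
# (`N x c :↔ "‖x‖ ≤ c"`; the `C^{1,1}` step behind the `ℓ = 2` slots of [ABKM19] Lemma 8.4 / Lemma 12.6)

`ParallelogramSecondDiff.norm_secondDiff_le_bilinear` turns a bound `M‖h‖²` for second differences along lines
into the BILINEAR parallelogram bound `4M‖y‖‖z‖` for maps into a normed group.  The `ℓ = 2` slots of the
[ABKM19] fine-tuning (Lemma 12.6 (12.53), slot (F4l2) of the rung route
`Summits/HubbardSuperconductivity/…/Theses/ComplexGFFStiffness`) are stated for norm-bound PREDICATES — the weak norm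
`‖·‖_{k+1}^{(A)} ≤ c` on polymer activities (`WeakNormLE`, `activityNormLE`), which are subadditive only on `C^{r₀}`
functionals — and for the entry-sum size `|·|₁` on tuning matrices, and the line bound is available only for SHORT
steps (`|h|₁ ≤ T`).  This file is the same elementary argument in that generality: an additive group `F` with a
predicate `N : F → ℝ → Prop` that is monotone, subadditive, symmetric and holds at `(0, 0)`; a real vector space `E`
with a size `σ` that is absolutely homogeneous and subadditive; a convex set `s` of base points:

* `secondDiff_eq_midpoint_add` — the two-midpoint identity with the steps written as `m + m`;
* `predicate_sum_range` — finite subadditivity of `N`;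
* `predicate_secondDiff_sq_max` — line bound `N (f(x+h+h) − f(x+h) − f(x+h) + f x) (M σ(h)²)` for `σ h ≤ T`
  ⟹ `N (Δ_yΔ_z f(q)) (2M·max(σ y, σ z)²)` for corners in `s`, `σ y, σ z ≤ T`;
* (private) `secondDiff_sum_telescope_nsmul` — `Δ_yΔ_{n•w} f(q) = Σ_{i<n} Δ_yΔ_w f(q + i•w)`;
* **`predicate_secondDiff_bilinear`** — `N (f(q+y+z) − f(q+y) − f(q+z) + f q) (4M·σ y·σ z)`.

Everything is proved; no named fact.  Honest scope: plumbing for block B4 of the stub `stub_f4l2ShrinkLoc` (line second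
differences of the RG map in the tuning parameter ⟹ parallelogram second differences); nothing about superconductivity
in the Hubbard model.

## References
* S. Adams, S. Buchholz, R. Kotecký, S. Müller, arXiv:1910.13564, Lemma 8.4 (`ℓ = 2`), Lemma 12.6 (12.53)
  [AdamsBuchholzKoteckyMuller2019].
-/

noncomputable section

namespace Literature.MathematicalPhysics.StatisticalMechanics.GradientRG

open Set

variable {E : Type*} [AddCommGroup E] [Module ℝ E] {F : Type*} [AddCommGroup F]

/-- **The two-midpoint identity, additive form**: with `m = ½(y+z)`, `m' = ½(z−y)`,
`f(q+y+z) − f(q+y) − f(q+z) + f(q) = [f(q+m+m) − f(q+m) − f(q+m) + f(q)] − [f(q+y+m'+m') − f(q+y+m') − f(q+y+m') + f(q+y)]`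
(`q + m = q + y + m'`). [cite: AdamsBuchholzKoteckyMuller2019, Lemma 8.4] -/
theorem secondDiff_eq_midpoint_add (f : E → F) (q y z : E) :
    f (q + y + z) - f (q + y) - f (q + z) + f q =
      (f (q + (1 / 2 : ℝ) • (y + z) + (1 / 2 : ℝ) • (y + z)) - f (q + (1 / 2 : ℝ) • (y + z)) -
          f (q + (1 / 2 : ℝ) • (y + z)) + f q) -
        (f (q + y + (1 / 2 : ℝ) • (z - y) + (1 / 2 : ℝ) • (z - y)) - f (q + y + (1 / 2 : ℝ) • (z - y)) -
          f (q + y + (1 / 2 : ℝ) • (z - y)) + f (q + y)) := by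
  have e1 : q + (1 / 2 : ℝ) • (y + z) + (1 / 2 : ℝ) • (y + z) = q + y + z := by module
  have e2 : q + y + (1 / 2 : ℝ) • (z - y) + (1 / 2 : ℝ) • (z - y) = q + z := by module
  have e3 : q + y + (1 / 2 : ℝ) • (z - y) = q + (1 / 2 : ℝ) • (y + z) := by module
  rw [e1, e2, e3]
  abel

/-- Points `q + u•y + t•z` (`t, u ∈ [0,1]`) of a parallelogram lie in every convex set containing its corners
(module version of `ParallelogramSecondDiff.parallelogram_mem_convex`, no norm needed; private plumbing).
[cite: AdamsBuchholzKoteckyMuller2019, Lemma 12.6 (the tuning ball is convex)] -/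
private theorem parallelogram_mem_convex_module {s : Set E} (hs : Convex ℝ s) {q y z : E} (hq : q ∈ s)
    (hqy : q + y ∈ s) (hqz : q + z ∈ s) (hqyz : q + y + z ∈ s) {t u : ℝ} (ht : t ∈ Icc (0 : ℝ) 1)
    (hu : u ∈ Icc (0 : ℝ) 1) : q + u • y + t • z ∈ s := by
  have h1 : q + t • z ∈ s := by
    have := hs.add_smul_sub_mem hq hqz ht
    simpa using this
  have h2 : q + y + t • z ∈ s := by
    have := hs.add_smul_sub_mem hqy hqyz ht
    simpa [add_assoc] using this
  have h3 := hs.add_smul_sub_mem h1 h2 hu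
  have e : q + t • z + u • (q + y + t • z - (q + t • z)) = q + u • y + t • z := by
    have : q + y + t • z - (q + t • z) = y := by abel
    rw [this]; abel
  rw [e] at h3
  exact h3

/-- **Square form for a predicate**: a monotone subadditive symmetric norm-bound predicate `N` on `F`, a size `σ` on
`E` (nonnegative, absolutely homogeneous, subadditive), a convex set `s`; if
`N (f(x+h+h) − f(x+h) − f(x+h) + f x) (M σ(h)²)` whenever `x, x+h, x+h+h ∈ s` and `σ h ≤ T`, then for corners
`q, q+y, q+z, q+y+z ∈ s` with `σ y, σ z ≤ T`: `N (Δ_yΔ_z f(q)) (2M·max(σ y, σ z)²)`.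
[cite: AdamsBuchholzKoteckyMuller2019, Lemma 8.4] -/
theorem predicate_secondDiff_sq_max {N : F → ℝ → Prop}
    (hmono : ∀ x c c', N x c → c ≤ c' → N x c')
    (hadd : ∀ x x' c c', N x c → N x' c' → N (x + x') (c + c'))
    (hneg : ∀ x c, N x c → N (-x) c)
    {σ : E → ℝ} (hσ0 : ∀ y, 0 ≤ σ y) (hσsmul : ∀ (c : ℝ) (y : E), σ (c • y) = |c| * σ y)
    (hσadd : ∀ y z, σ (y + z) ≤ σ y + σ z)
    {s : Set E} (hs : Convex ℝ s) {f : E → F} {M T : ℝ} (hM : 0 ≤ M)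
    (hline : ∀ x h : E, x ∈ s → x + h ∈ s → x + h + h ∈ s → σ h ≤ T →
      N (f (x + h + h) - f (x + h) - f (x + h) + f x) (M * σ h ^ 2))
    {q y z : E} (hq : q ∈ s) (hqy : q + y ∈ s) (hqz : q + z ∈ s) (hqyz : q + y + z ∈ s)
    (hyT : σ y ≤ T) (hzT : σ z ≤ T) :
    N (f (q + y + z) - f (q + y) - f (q + z) + f q) (2 * M * max (σ y) (σ z) ^ 2) := by
  rw [secondDiff_eq_midpoint_add]
  have hσneg : ∀ y : E, σ (-y) = σ y := fun y => by
    rw [show -y = (-1 : ℝ) • y by simp, hσsmul]; simp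
  have hσsub : ∀ y z : E, σ (z - y) ≤ σ z + σ y := fun y z => by
    rw [sub_eq_add_neg]; exact (hσadd z (-y)).trans (by rw [hσneg])
  -- the midpoint lies in `s`
  have hm : q + (1 / 2 : ℝ) • (y + z) ∈ s := by
    have := parallelogram_mem_convex_module hs hq hqy hqz hqyz (t := 1 / 2) (u := 1 / 2)
      ⟨by norm_num, by norm_num⟩ ⟨by norm_num, by norm_num⟩
    rw [smul_add]
    convert this using 1
    abel
  have e3 : q + y + (1 / 2 : ℝ) • (z - y) = q + (1 / 2 : ℝ) • (y + z) := by module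
  have hm' : q + y + (1 / 2 : ℝ) • (z - y) ∈ s := by rw [e3]; exact hm
  have h2a : q + (1 / 2 : ℝ) • (y + z) + (1 / 2 : ℝ) • (y + z) ∈ s := by
    have e : q + (1 / 2 : ℝ) • (y + z) + (1 / 2 : ℝ) • (y + z) = q + y + z := by module
    rw [e]; exact hqyz
  have h2b : q + y + (1 / 2 : ℝ) • (z - y) + (1 / 2 : ℝ) • (z - y) ∈ s := by
    have e : q + y + (1 / 2 : ℝ) • (z - y) + (1 / 2 : ℝ) • (z - y) = q + z := by module
    rw [e]; exact hqz
  have hmx : 0 ≤ max (σ y) (σ z) := le_max_of_le_left (hσ0 _)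
  have hn1 : σ ((1 / 2 : ℝ) • (y + z)) ≤ max (σ y) (σ z) := by
    rw [hσsmul, abs_of_nonneg (by norm_num : (0 : ℝ) ≤ 1 / 2)]
    calc (1 / 2 : ℝ) * σ (y + z) ≤ (1 / 2) * (σ y + σ z) := by gcongr; exact hσadd _ _
      _ ≤ max (σ y) (σ z) := by
          have := le_max_left (σ y) (σ z); have := le_max_right (σ y) (σ z); linarith
  have hn2 : σ ((1 / 2 : ℝ) • (z - y)) ≤ max (σ y) (σ z) := by
    rw [hσsmul, abs_of_nonneg (by norm_num : (0 : ℝ) ≤ 1 / 2)]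
    calc (1 / 2 : ℝ) * σ (z - y) ≤ (1 / 2) * (σ z + σ y) := by gcongr; exact hσsub _ _
      _ ≤ max (σ y) (σ z) := by
          have := le_max_left (σ y) (σ z); have := le_max_right (σ y) (σ z); linarith
  have hT1 : σ ((1 / 2 : ℝ) • (y + z)) ≤ T := hn1.trans (max_le hyT hzT)
  have hT2 : σ ((1 / 2 : ℝ) • (z - y)) ≤ T := hn2.trans (max_le hyT hzT)
  have hA := hline q ((1 / 2 : ℝ) • (y + z)) hq hm h2a hT1
  have hB := hline (q + y) ((1 / 2 : ℝ) • (z - y)) hqy hm' h2b hT2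
  have hA' : N (f (q + (1 / 2 : ℝ) • (y + z) + (1 / 2 : ℝ) • (y + z)) - f (q + (1 / 2 : ℝ) • (y + z)) -
      f (q + (1 / 2 : ℝ) • (y + z)) + f q) (M * max (σ y) (σ z) ^ 2) :=
    hmono _ _ _ hA (mul_le_mul_of_nonneg_left (pow_le_pow_left₀ (hσ0 _) hn1 2) hM)
  have hB' : N (-(f (q + y + (1 / 2 : ℝ) • (z - y) + (1 / 2 : ℝ) • (z - y)) - f (q + y + (1 / 2 : ℝ) • (z - y)) -
      f (q + y + (1 / 2 : ℝ) • (z - y)) + f (q + y))) (M * max (σ y) (σ z) ^ 2) :=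
    hneg _ _ (hmono _ _ _ hB (mul_le_mul_of_nonneg_left (pow_le_pow_left₀ (hσ0 _) hn2 2) hM))
  have h := hadd _ _ _ _ hA' hB'
  rw [← sub_eq_add_neg] at h
  exact hmono _ _ _ h (by ring_nf; exact le_rfl)

omit [Module ℝ E] in
/-- **Telescoping a parallelogram along one side**, additive-group form with natural multiples:
`Δ_yΔ_{n•w} f(q) = Σ_{i<n} Δ_yΔ_w f(q + i•w)` (private plumbing; cf. `ParallelogramSecondDiff.secondDiff_sum_telescope`
for normed spaces). [cite: AdamsBuchholzKoteckyMuller2019, Lemma 8.4] -/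
private theorem secondDiff_sum_telescope_nsmul (f : E → F) (q y w : E) (n : ℕ) :
    ∑ i ∈ Finset.range n, (f (q + i • w + y + w) - f (q + i • w + y) - f (q + i • w + w)
      + f (q + i • w)) =
      f (q + y + n • w) - f (q + y) - f (q + n • w) + f q := by
  induction n with
  | zero => simp
  | succ n ih =>
    rw [Finset.sum_range_succ, ih]
    have e1 : q + n • w + y + w = q + y + (n + 1) • w := by rw [succ_nsmul]; abel
    have e2 : q + n • w + w = q + (n + 1) • w := by rw [succ_nsmul]; abel
    have e3 : q + n • w + y = q + y + n • w := by abel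
    rw [e1, e2, e3]
    abel

/-- `N (Σ_{i<n} x_i) (Σ_{i<n} c_i)` from the termwise bounds (subadditivity and `N 0 0`; the finite subadditivity used
in the telescoping step). [cite: AdamsBuchholzKoteckyMuller2019, Lemma 8.4] -/
theorem predicate_sum_range {N : F → ℝ → Prop} (hzero : N 0 0)
    (hadd : ∀ x x' c c', N x c → N x' c' → N (x + x') (c + c'))
    {x : ℕ → F} {c : ℕ → ℝ} (n : ℕ) (h : ∀ i, i < n → N (x i) (c i)) :
    N (∑ i ∈ Finset.range n, x i) (∑ i ∈ Finset.range n, c i) := by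
  induction n with
  | zero => simpa using hzero
  | succ n ih =>
    rw [Finset.sum_range_succ, Finset.sum_range_succ]
    exact hadd _ _ _ _ (ih fun i hi => h i (by omega)) (h n (by omega))

/-- **Bilinear parallelogram bound for a predicate** (module docstring): under the hypotheses of
`predicate_secondDiff_sq_max` plus `N 0 0` and definiteness of the size (`σ y = 0 → y = 0`), for every parallelogram with
corners `q, q+y, q+z, q+y+z ∈ s` and `σ y, σ z ≤ T`: `N (f(q+y+z) − f(q+y) − f(q+z) + f q) (4M·σ y·σ z)`.
[cite: AdamsBuchholzKoteckyMuller2019, Lemma 8.4 / Lemma 12.6 (12.53)] -/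
theorem predicate_secondDiff_bilinear {N : F → ℝ → Prop} (hzero : N 0 0)
    (hmono : ∀ x c c', N x c → c ≤ c' → N x c')
    (hadd : ∀ x x' c c', N x c → N x' c' → N (x + x') (c + c'))
    (hneg : ∀ x c, N x c → N (-x) c)
    {σ : E → ℝ} (hσ0 : ∀ y, 0 ≤ σ y) (hσsmul : ∀ (c : ℝ) (y : E), σ (c • y) = |c| * σ y)
    (hσadd : ∀ y z, σ (y + z) ≤ σ y + σ z) (hσdef : ∀ y, σ y = 0 → y = 0)
    {s : Set E} (hs : Convex ℝ s) {f : E → F} {M T : ℝ} (hM : 0 ≤ M)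
    (hline : ∀ x h : E, x ∈ s → x + h ∈ s → x + h + h ∈ s → σ h ≤ T →
      N (f (x + h + h) - f (x + h) - f (x + h) + f x) (M * σ h ^ 2))
    {q y z : E} (hq : q ∈ s) (hqy : q + y ∈ s) (hqz : q + z ∈ s) (hqyz : q + y + z ∈ s)
    (hyT : σ y ≤ T) (hzT : σ z ≤ T) :
    N (f (q + y + z) - f (q + y) - f (q + z) + f q) (4 * M * σ y * σ z) := by
  -- reduce to `σ y ≤ σ z` by symmetry
  wlog hyz : σ y ≤ σ z generalizing y z
  · have h := this hqz hqy (by rw [add_right_comm]; exact hqyz) hzT hyT (le_of_not_ge hyz)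
    have e : f (q + z + y) - f (q + z) - f (q + y) + f q = f (q + y + z) - f (q + y) - f (q + z) + f q := by
      rw [add_right_comm q z y]; abel
    rw [e] at h
    exact hmono _ _ _ h (le_of_eq (by ring))
  by_cases hy0 : σ y = 0
  · -- degenerate short side: `y = 0` and the second difference vanishes
    have hy : y = 0 := hσdef y hy0
    subst hy
    have e : f (q + 0 + z) - f (q + 0) - f (q + z) + f q = 0 := by rw [add_zero]; abel
    rw [e, hy0]
    exact hmono _ _ _ hzero (by simp)
  have hypos : 0 < σ y := lt_of_le_of_ne (hσ0 _) (Ne.symm hy0)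
  -- cut `z` into `n` pieces of size `≤ σ y`
  set n : ℕ := ⌈σ z / σ y⌉₊ with hndef
  have hn1 : 1 ≤ n := by
    rw [hndef, Nat.one_le_ceil_iff]
    exact div_pos (lt_of_lt_of_le hypos hyz) hypos
  have hnpos : (0 : ℝ) < n := by exact_mod_cast hn1
  have hnle : (n : ℝ) ≤ σ z / σ y + 1 := by
    rw [hndef]; exact (Nat.ceil_lt_add_one (div_nonneg (hσ0 z) hypos.le)).le
  have hnge : σ z / σ y ≤ n := by rw [hndef]; exact Nat.le_ceil _
  set w : E := (1 / (n : ℝ)) • z with hwdef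
  have hnw : (n : ℝ) • w = z := by rw [hwdef, smul_smul]; field_simp; rw [one_smul]
  have hwnorm : σ w = σ z / n := by
    rw [hwdef, hσsmul, abs_of_nonneg (by positivity)]; ring
  have hwy : σ w ≤ σ y := by
    rw [hwnorm, div_le_iff₀ hnpos]
    calc σ z = σ z / σ y * σ y := by field_simp
      _ ≤ n * σ y := mul_le_mul_of_nonneg_right hnge (hσ0 _)
      _ = σ y * n := mul_comm _ _
  have hwT : σ w ≤ T := hwy.trans hyT
  -- every small parallelogram has its corners in `s`
  have hcorner : ∀ i : ℕ, i ≤ n → ∀ u ∈ Icc (0 : ℝ) 1, q + (i : ℝ) • w + u • y ∈ s := by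
    intro i hi u hu
    have ht : ((i : ℝ) / n) ∈ Icc (0 : ℝ) 1 :=
      ⟨by positivity, by rw [div_le_one hnpos]; exact_mod_cast hi⟩
    have h := parallelogram_mem_convex_module hs hq hqy hqz hqyz ht hu
    have e : ((i : ℝ) / n) • z = (i : ℝ) • w := by rw [hwdef, smul_smul]; congr 1; field_simp
    rw [e, add_right_comm] at h
    exact h
  have hterm : ∀ i, i < n →
      N (f (q + (i : ℝ) • w + y + w) - f (q + (i : ℝ) • w + y) - f (q + (i : ℝ) • w + w) + f (q + (i : ℝ) • w))
        (2 * M * σ y ^ 2) := by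
    intro i hi
    have hi' : i + 1 ≤ n := hi
    have h0 : q + (i : ℝ) • w ∈ s := by simpa using hcorner i (by omega) 0 ⟨le_rfl, zero_le_one⟩
    have h1 : q + (i : ℝ) • w + y ∈ s := by simpa using hcorner i (by omega) 1 ⟨zero_le_one, le_rfl⟩
    have h2 : q + (i : ℝ) • w + w ∈ s := by
      have := hcorner (i + 1) hi' 0 ⟨le_rfl, zero_le_one⟩
      simp only [zero_smul, add_zero, Nat.cast_add, Nat.cast_one, add_smul, one_smul, ← add_assoc] at this
      exact this
    have h3 : q + (i : ℝ) • w + y + w ∈ s := by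
      have := hcorner (i + 1) hi' 1 ⟨zero_le_one, le_rfl⟩
      simp only [one_smul, Nat.cast_add, Nat.cast_one, add_smul, ← add_assoc] at this
      rw [add_right_comm (q + (i : ℝ) • w) y w]
      exact this
    have h := predicate_secondDiff_sq_max hmono hadd hneg hσ0 hσsmul hσadd hs hM hline h0 h1 h2 h3 hyT hwT
    have hmax : max (σ y) (σ w) = σ y := max_eq_left hwy
    rw [hmax] at h
    exact h
  have hsum := secondDiff_sum_telescope_nsmul f q y w n
  have hnw' : n • w = z := by rw [← Nat.cast_smul_eq_nsmul ℝ, hnw]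
  rw [hnw'] at hsum
  rw [← hsum]
  have hterm' : ∀ i, i < n →
      N (f (q + i • w + y + w) - f (q + i • w + y) - f (q + i • w + w) + f (q + i • w)) (2 * M * σ y ^ 2) := by
    intro i hi
    have h := hterm i hi
    rw [Nat.cast_smul_eq_nsmul] at h
    exact h
  have hS := predicate_sum_range hzero hadd n hterm'
  refine hmono _ _ _ hS ?_
  rw [Finset.sum_const, Finset.card_range, nsmul_eq_mul]
  calc (n : ℝ) * (2 * M * σ y ^ 2) ≤ (σ z / σ y + 1) * (2 * M * σ y ^ 2) :=
        mul_le_mul_of_nonneg_right hnle (by positivity)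
    _ ≤ (2 * (σ z / σ y)) * (2 * M * σ y ^ 2) := by
        refine mul_le_mul_of_nonneg_right ?_ (by positivity)
        have : 1 ≤ σ z / σ y := by rw [le_div_iff₀ hypos, one_mul]; exact hyz
        linarith
    _ = 4 * M * σ y * σ z := by field_simp; ring

end Literature.MathematicalPhysics.StatisticalMechanics.GradientRG

end
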